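import Summits.HodgeConjecture.HodgeConjecture.Theorems.Ring2DeformAtlasSixfolds
import HarnessLib

/-!
# Ring 2 · deform axis, part X — reading (1.1) in kernel form: anchored invariant-cycles families

HONEST FRAMING (cell `pub-hodge-ring2`, verbatim): research route conditional on HC_CM; not a corollary;
Q11.4-sentence-2 already refuted in dim ≥ 3.

`HC_CM` := `Theses.RankFourFaces.CMAbelianHodge` (stmt-HodgeConjecture-3052) does NOT occur in this file: that is the
point. Parts VII–IX showed that the localised row U (`CMSpreadingTo f n s`, `CMSpreadingAt A`) is, granted `HC_CM` and
fact #20, exactly the Hodge conjecture at the fibre, and listed (RING2-MAP §deform D.34–D.41) the Mumford–Tate families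
whose CM fibres are FREE ANCHORS — fibres where HC is already a theorem of the tree (powers of one CM elliptic curve;
powers of `E × E^{K+1}`; modulo the refereed named fact Tankeev–Ribet, powers `B^{N+1}` of a simple abelian variety of
prime dimension and the K3-partner fibres `(B × B) × B`). On such a family the deformation input that carries HC to
the other fibres is Abdulali's invariant-cycles property (1.1) (`InvariantCyclesHoldFor`, a PREDICATE on the family —
nothing is asserted about any family) and `HC_CM` is dispensable ("KIND 1" of D.34). This part records that reading
as theorems (no definition, no new `@[conjecture]` node, no `sorry`):

§1 `cmSpreadingTo_of_invariantCycles_of_mem_anchorLocus`: (1.1) on `f` and ONE anchor fibre anywhere on `f` give the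
   localised row U at EVERY fibre of `f` (the CM locus is not even used) — typer 2's engine
   `forall_mem_algebraicClasses_of_invariantCycles_of_anchor` read on part VII's predicate.
§2 For each free-anchor chart of parts VIII/IX: (1.1) on a smooth projective family `f` one of whose fibres is so
   charted gives (a) the localised row U at every fibre and (b) the Hodge conjecture at every HODGE-GENERIC fibre
   (`HodgeClassesExtendAt f n s`: every Hodge class of `𝒳_s` is the restriction of a fibrewise-Hodge global class) —
   typer 2's `hodgeConjectureFor_fiber_of_invariantCycles_of_anchor_of_extend` with the anchor supplied by the chart.
   Charts: `A₀ ~ E^{N+1}` and `(E × Y₀)^{M+1}`, `Y₀ ~ E^{K+1}` (`E` a CM elliptic curve; NO named fact); `A₀ ~ B^{N+1}`,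
   `B` simple of prime dimension, and `X₀ ~ Y₀ × Z`, `Y₀ ~ B × B`, `Z ~ B`, `B` a simple surface (modulo Tankeev–Ribet,
   binder `h`).

What this does NOT say: that any particular family satisfies (1.1) (OPEN in relative dimension ≥ 4 outside the
known columns — it is the complex-base node (CS) of part I up to the anchor), nor that a given fibre is Hodge-generic,
nor which CM points lie on which family (recorded, with two-method certification, in RING2-MAP §deform D.41 and taken
here as the chart HYPOTHESIS `e₀`). Nothing here decides `HC_CM`, `HC_AV` or any atlas cell.

On the hypothesis `HodgeClassesExtendAt f n s` of the §2 (b) theorems (reading, RING2-MAP §deform gen 13 D.46): at the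
base fibre `A ≅ 𝒳_s` of the Mumford–Tate family OF `A` it is what Deligne's construction provides class by class
(fact #20: each Hodge class of `A` extends to a fibrewise-Hodge global class) — every abelian variety is Hodge-generic
in its own Mumford–Tate family; the content of (b) is that ONE free anchor elsewhere on that family then suffices.

Sources: [Abdulali 1994, (1.1) p. 1122 and Lemma 6.2 p. 1131]; [Deligne 1982, §6 Prop. 6.1]; [Charles–Schnell 2014 =
arXiv:1101.3647, Conj. 11.3.1, Prop. 11.3.5, Thm. 11.3.4, Thm. 11.5.11]; [van Geemen 1994, LNM 1594, Thm. 4.3];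
[Moonen–Zarhin 1999 = arXiv:math/9901113, §2 (2.7); §4 (isogeny classes of simple CM surfaces by a quartic CM field,
arXiv p. 8 — not §5 "Case 1", which is the `E × Y` fivefold analysis: cell referee F44)]; [André 1996, Thm. 0.6.2 (the
shape "(1.1) + one good fibre")].
-/

set_option linter.dupNamespace false

noncomputable section

namespace Summit.HodgeConjecture.HodgeConjecture.Ring2.Deform

open CategoryTheory AlgebraicGeometry
open Literature.AlgebraicGeometry Literature.AlgebraicGeometry.Motives
open Literature.AlgebraicGeometry.HodgeTheory
open Literature.AlgebraicTopology.SingularHomology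
open Literature.AlgebraicGeometry.Abdulali1994 (InvariantCyclesHoldFor)
open Summit.HodgeConjecture.HodgeConjecture
open Summit.HodgeConjecture.HodgeConjecture.Ring2.Hypotheses (anchorLocus mem_anchorLocus_of_chart
  HodgeClassesExtendAt forall_mem_algebraicClasses_of_invariantCycles_of_anchor
  hodgeConjectureFor_fiber_of_invariantCycles_of_anchor_of_extend)


variable {𝒳 S : SchemeOver ℂ}

/-! ## §1 — (1.1) and one anchor give the localised row U at every fibre -/

/-- **(1.1) + ONE anchor fibre ⟹ the localised row U at EVERY fibre** (the CM locus is not used: a fibrewise-Hodge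
global class is algebraic at the anchor, hence everywhere by (1.1)). This is reading (1.1) of RING2-MAP D.34 in
kernel form; compare part VII `cmSpreadingTo_of_invariantCyclesHoldFor` (anchor = a CM fibre under `HC_CM`).
[cite: Abdulali1994FamiliesAV, (1.1) (p. 1122) and Lemma 6.2 (p. 1131)] [cite: Deligne1982HodgeCycles, §6 Prop. 6.1] -/
theorem cmSpreadingTo_of_invariantCycles_of_mem_anchorLocus {f : 𝒳 ⟶ S} {n : ℕ}
    (hIC : InvariantCyclesHoldFor f n) {s₀ : ComplexPoints S} (hs₀ : s₀ ∈ anchorLocus f n)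
    (s₁ : ComplexPoints S) : CMSpreadingTo f n s₁ :=
  fun _ W hW _ => forall_mem_algebraicClasses_of_invariantCycles_of_anchor hIC hs₀ W hW s₁

/-- … with the anchor given by a CHART `X₀ ≅ 𝒳_{s₀}` of a variety for which HC is known.
[cite: Abdulali1994FamiliesAV, Lemma 6.2 (p. 1131)] [cite: Deligne1982HodgeCycles, §6 Prop. 6.1] -/
theorem cmSpreadingTo_of_invariantCycles_of_chart {f : 𝒳 ⟶ S} {n : ℕ} (hIC : InvariantCyclesHoldFor f n)
    {s₀ : ComplexPoints S} {X₀ : SchemeOver ℂ} (e₀ : X₀ ≅ fiberOver f s₀) (h₀ : HodgeConjectureFor n X₀)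
    (s₁ : ComplexPoints S) : CMSpreadingTo f n s₁ :=
  cmSpreadingTo_of_invariantCycles_of_mem_anchorLocus hIC (mem_anchorLocus_of_chart e₀ h₀) s₁

/-- **(1.1) + ONE charted anchor + Hodge-genericity of `𝒳_s` ⟹ HC at `𝒳_s`** (typer 2's engine with the anchor
supplied by a chart). [cite: Abdulali1994FamiliesAV, Lemma 6.2 (p. 1131)] [cite: CharlesSchnell2014Notes, Prop. 11.3.5] -/
theorem hodgeConjectureFor_fiber_of_invariantCycles_of_chart_of_extend {f : 𝒳 ⟶ S} {n : ℕ}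
    (hf : IsSmoothProjectiveFamily f n) (hIC : InvariantCyclesHoldFor f n) {s₀ : ComplexPoints S}
    {X₀ : SchemeOver ℂ} (e₀ : X₀ ≅ fiberOver f s₀) (h₀ : HodgeConjectureFor n X₀) {s : ComplexPoints S}
    (hs : HodgeClassesExtendAt f n s) : HodgeConjectureFor n (fiberOver f s) :=
  hodgeConjectureFor_fiber_of_invariantCycles_of_anchor_of_extend hf hIC ⟨s₀, mem_anchorLocus_of_chart e₀ h₀⟩ hs

/-! ## §2 — The free-anchor charts of parts VIII/IX on an invariant-cycles family -/

section CMEllipticPowers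

variable {E : AbelianVariety ℂ} (hE : E.dim = 1) (φ : E ⟶ E) {d : ℕ} (hd : 0 < d) (hφ : φ ≫ φ = -(d • 𝟙 E))
include hE hd hφ

/-- **`E^{N+1}`-charted families (no named fact, no `HC_CM`)**: if (1.1) holds on `f` and one fibre is charted by
`A₀ ~ E^{N+1}`, `E` an elliptic curve with complex multiplication, the localised row U holds at every fibre of `f`.
Cases: the `E_{k'}⁶` points of the `kE₀`-Weil sixfold families (D.37 (b)), the `E_{K_Ψ}⁶` points of the
`K_Ψ`-diagonal type III(1) sixfold families and the `E_k⁶` points of the `(1,1)³` sextic Weil families (D.41).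
[cite: vanGeemen1994HodgeAV, Thm. 4.3] [cite: Abdulali1994FamiliesAV, (1.1) and Lemma 6.2] -/
theorem cmSpreadingTo_of_invariantCycles_of_chart_of_isIsogenous_powSucc_of_cm {f : 𝒳 ⟶ S} {n : ℕ}
    (hIC : InvariantCyclesHoldFor f n) {s₀ : ComplexPoints S} (A₀ : AbelianVariety ℂ)
    (e₀ : A₀.X ≅ fiberOver f s₀) (hdim : A₀.dim = n) (N : ℕ) (hiso : A₀.IsIsogenous (E.powSucc N))
    (s₁ : ComplexPoints S) : CMSpreadingTo f n s₁ :=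
  cmSpreadingTo_of_invariantCycles_of_mem_anchorLocus hIC
    (Hypotheses.mem_anchorLocus_of_chart_of_isIsogenous_powSucc_of_cm A₀ e₀ hdim hE φ hd hφ N hiso) s₁

/-- … and HC holds at every Hodge-generic fibre of such a family.
[cite: vanGeemen1994HodgeAV, Thm. 4.3] [cite: Abdulali1994FamiliesAV, Lemma 6.2 (p. 1131)] -/
theorem hodgeConjectureFor_fiber_of_invariantCycles_of_chart_of_isIsogenous_powSucc_of_cm_of_extend
    {f : 𝒳 ⟶ S} {n : ℕ} (hf : IsSmoothProjectiveFamily f n) (hIC : InvariantCyclesHoldFor f n)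
    {s₀ : ComplexPoints S} (A₀ : AbelianVariety ℂ) (e₀ : A₀.X ≅ fiberOver f s₀) (hdim : A₀.dim = n) (N : ℕ)
    (hiso : A₀.IsIsogenous (E.powSucc N)) {s : ComplexPoints S} (hs : HodgeClassesExtendAt f n s) :
    HodgeConjectureFor n (fiberOver f s) :=
  hodgeConjectureFor_fiber_of_invariantCycles_of_anchor_of_extend hf hIC
    ⟨s₀, Hypotheses.mem_anchorLocus_of_chart_of_isIsogenous_powSucc_of_cm A₀ e₀ hdim hE φ hd hφ N hiso⟩ hs

/-- **`(E × Y₀)^{M+1}`-charted families, `Y₀ ~ E^{K+1}` (no named fact, no `HC_CM`)** — the diagonal CM points of the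
`k`-line cells `E × Y₅`, `E × Y₆`, all powers (D.41 (4)): (1.1) on `f` gives the localised row U at every fibre.
[cite: vanGeemen1994HodgeAV, Thm. 4.3] [cite: Abdulali1994FamiliesAV, (1.1) and Lemma 6.2] -/
theorem cmSpreadingTo_of_invariantCycles_of_chart_powSucc_prod_of_isIsogenous_powSucc_of_cm {f : 𝒳 ⟶ S}
    {n : ℕ} (hIC : InvariantCyclesHoldFor f n) {s₀ : ComplexPoints S} (K : ℕ) {Y₀ : AbelianVariety ℂ}
    (hY : Y₀.IsIsogenous (E.powSucc K)) (M : ℕ) (e₀ : ((E.prod Y₀).powSucc M).X ≅ fiberOver f s₀)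
    (hn : ((E.prod Y₀).powSucc M).dim = n) (s₁ : ComplexPoints S) : CMSpreadingTo f n s₁ :=
  cmSpreadingTo_of_invariantCycles_of_chart hIC e₀
    (hn ▸ hodgeConjectureFor_powSucc_prod_of_isIsogenous_powSucc_of_cm hE φ hd hφ K hY M) s₁

/-- … and HC holds at every Hodge-generic fibre of such a family.
[cite: vanGeemen1994HodgeAV, Thm. 4.3] [cite: Abdulali1994FamiliesAV, Lemma 6.2 (p. 1131)] -/
theorem hodgeConjectureFor_fiber_of_invariantCycles_of_chart_powSucc_prod_of_cm_of_extend {f : 𝒳 ⟶ S}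
    {n : ℕ} (hf : IsSmoothProjectiveFamily f n) (hIC : InvariantCyclesHoldFor f n) {s₀ : ComplexPoints S}
    (K : ℕ) {Y₀ : AbelianVariety ℂ} (hY : Y₀.IsIsogenous (E.powSucc K)) (M : ℕ)
    (e₀ : ((E.prod Y₀).powSucc M).X ≅ fiberOver f s₀) (hn : ((E.prod Y₀).powSucc M).dim = n)
    {s : ComplexPoints S} (hs : HodgeClassesExtendAt f n s) : HodgeConjectureFor n (fiberOver f s) :=
  hodgeConjectureFor_fiber_of_invariantCycles_of_chart_of_extend hf hIC e₀
    (hn ▸ hodgeConjectureFor_powSucc_prod_of_isIsogenous_powSucc_of_cm hE φ hd hφ K hY M) hs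

end CMEllipticPowers

/-- **`B^{N+1}`-charted families, `B` simple of prime dimension (modulo Tankeev–Ribet, binder `h`; no `HC_CM`)** —
the Weyl CM points `~ B²` of every type III(1) sixfold family and the `B²` points of the `(1,1)³` sextic Weil families
(prime `3`), the `B²` points of the type III(1) fourfold Shimura curves (prime `2`) (D.37, D.41): (1.1) on `f` gives
the localised row U at every fibre. [cite: MoonenZarhin1999LowDim, §2 Thm. (2.7)]
[cite: Abdulali1994FamiliesAV, (1.1) and Lemma 6.2] -/
theorem cmSpreadingTo_of_invariantCycles_of_chart_of_isIsogenous_powSucc_simplePrimeDim_of_tankeevRibet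
    (h : TankeevRibet1983_hodgeClasses_divisorial_powers_simplePrimeDimension) {f : 𝒳 ⟶ S} {n : ℕ}
    (hIC : InvariantCyclesHoldFor f n) {s₀ : ComplexPoints S} (A₀ : AbelianVariety ℂ)
    (e₀ : A₀.X ≅ fiberOver f s₀) (hdim : A₀.dim = n) (B : AbelianVariety ℂ) {p : ℕ} (hp : p.Prime)
    (hB : B.dim = p) (hs : B.IsSimple) (N : ℕ) (hiso : A₀.IsIsogenous (B.powSucc N))
    (s₁ : ComplexPoints S) : CMSpreadingTo f n s₁ :=
  cmSpreadingTo_of_invariantCycles_of_chart hIC e₀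
    (hdim ▸ hodgeConjectureFor_of_isIsogenous_powSucc_simplePrimeDim_of_tankeevRibet h B hp hB hs N hiso) s₁

/-- … and HC holds at every Hodge-generic fibre of such a family (modulo Tankeev–Ribet).
[cite: MoonenZarhin1999LowDim, §2 Thm. (2.7)] [cite: Abdulali1994FamiliesAV, Lemma 6.2 (p. 1131)] -/
theorem hodgeConjectureFor_fiber_of_invariantCycles_of_chart_simplePrimeDim_of_tankeevRibet_of_extend
    (h : TankeevRibet1983_hodgeClasses_divisorial_powers_simplePrimeDimension) {f : 𝒳 ⟶ S} {n : ℕ}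
    (hf : IsSmoothProjectiveFamily f n) (hIC : InvariantCyclesHoldFor f n) {s₀ : ComplexPoints S}
    (A₀ : AbelianVariety ℂ) (e₀ : A₀.X ≅ fiberOver f s₀) (hdim : A₀.dim = n) (B : AbelianVariety ℂ) {p : ℕ}
    (hp : p.Prime) (hB : B.dim = p) (hs : B.IsSimple) (N : ℕ) (hiso : A₀.IsIsogenous (B.powSucc N))
    {s : ComplexPoints S} (hgen : HodgeClassesExtendAt f n s) : HodgeConjectureFor n (fiberOver f s) :=
  hodgeConjectureFor_fiber_of_invariantCycles_of_chart_of_extend hf hIC e₀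
    (hdim ▸ hodgeConjectureFor_of_isIsogenous_powSucc_simplePrimeDim_of_tankeevRibet h B hp hB hs N hiso) hgen

/-- **K3-partner families at `E` cyclic (or `D₄` of `L`-type), chart `X₀ ~ Y₀ × Z`, `Y₀ ~ B × B`, `Z ~ B`, `B` a simple
surface (modulo Tankeev–Ribet; no `HC_CM`)** (D.41 (3)): (1.1) on `f` gives the localised row U at every fibre.
[cite: MoonenZarhin1999LowDim, §4 (quartic-CM-field dichotomy preceding the Proposition on X₁ × X₂, arXiv p. 8)]
[cite: Abdulali1994FamiliesAV, (1.1) and Lemma 6.2] -/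
theorem cmSpreadingTo_of_invariantCycles_of_chart_of_isIsogenous_prod_sq_of_tankeevRibet
    (h : TankeevRibet1983_hodgeClasses_divisorial_powers_simplePrimeDimension) {f : 𝒳 ⟶ S} {n : ℕ}
    (hIC : InvariantCyclesHoldFor f n) {s₀ : ComplexPoints S} (X₀ : AbelianVariety ℂ)
    (e₀ : X₀.X ≅ fiberOver f s₀) (hdim : X₀.dim = n) (B : AbelianVariety ℂ) (hB : B.dim = 2) (hs : B.IsSimple)
    {Y₀ Z : AbelianVariety ℂ} (hX : X₀.IsIsogenous (Y₀.prod Z)) (hY : Y₀.IsIsogenous (B.prod B))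
    (hZ : Z.IsIsogenous B) (s₁ : ComplexPoints S) : CMSpreadingTo f n s₁ :=
  cmSpreadingTo_of_invariantCycles_of_chart hIC e₀
    (hdim ▸ hodgeConjectureFor_of_isIsogenous_prod_sq_of_tankeevRibet h B hB hs hX hY hZ) s₁

/-- … and HC holds at every Hodge-generic fibre of such a family (modulo Tankeev–Ribet) — the K3-partner cell at
`E` cyclic is carried by (1.1) on ONE Shimura curve, `HC_CM` dispensable (answer to RING2-MAP L4.7 in kernel form);
`hgen` holds at the member `Y × Z_Y` itself when `f` is its own Mumford–Tate pencil (module docstring; D.46).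
[cite: MoonenZarhin1999LowDim, §4 (quartic-CM-field dichotomy, arXiv p. 8)]
[cite: Abdulali1994FamiliesAV, Lemma 6.2 (p. 1131)] [cite: CharlesSchnell2014Notes, Thm. 11.5.11 (a)–(c)] -/
theorem hodgeConjectureFor_fiber_of_invariantCycles_of_chart_prod_sq_of_tankeevRibet_of_extend
    (h : TankeevRibet1983_hodgeClasses_divisorial_powers_simplePrimeDimension) {f : 𝒳 ⟶ S} {n : ℕ}
    (hf : IsSmoothProjectiveFamily f n) (hIC : InvariantCyclesHoldFor f n) {s₀ : ComplexPoints S}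
    (X₀ : AbelianVariety ℂ) (e₀ : X₀.X ≅ fiberOver f s₀) (hdim : X₀.dim = n) (B : AbelianVariety ℂ)
    (hB : B.dim = 2) (hs : B.IsSimple) {Y₀ Z : AbelianVariety ℂ} (hX : X₀.IsIsogenous (Y₀.prod Z))
    (hY : Y₀.IsIsogenous (B.prod B)) (hZ : Z.IsIsogenous B) {s : ComplexPoints S}
    (hgen : HodgeClassesExtendAt f n s) : HodgeConjectureFor n (fiberOver f s) :=
  hodgeConjectureFor_fiber_of_invariantCycles_of_chart_of_extend hf hIC e₀
    (hdim ▸ hodgeConjectureFor_of_isIsogenous_prod_sq_of_tankeevRibet h B hB hs hX hY hZ) hgen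

end Summit.HodgeConjecture.HodgeConjecture.Ring2.Deform
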